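import Mathlib
import Summits.Ventures.HodgeRepro.PeriodCloserC7Chain
import Summits.Ventures.HodgeRepro.PeriodCloserC7Identification

/-!
# PeriodCloserC7IdentificationChain — the closer C7 from the components of the identification

Blind re-derivation cell `pub-hodge-repro`, seat night-2 (gen 2).  Target tree path
`lean/Summits/Ventures/HodgeRepro/PeriodCloserC7IdentificationChain.lean`.

`PeriodCloserC7Identification.lean` refines the ONE unprinted hypothesis `Identification I` of the chain
(`PeriodCloserC7Chain.lean`, `S4face_of_chain`) into the components (D0)–(D4) and (S1)–(S3) and composes them
(`identification_of_components`).  This file re-bundles the hypotheses of the chain with `ident` replaced by the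
components (`ChainHypothesesRefined`) and runs the main theorem from them (`S4face_of_components`), with the chain
of equivalences (`chain_of_equivalences_of_components`).  An interface theorem is exactly as strong as the logical
chain it encodes; every automorphic object is a parameter; no statement of ROUTE.md (S4, S4 on the faces, (P)) is
closed, and nothing here says anything about the status of the Hodge conjecture for CM abelian varieties, which is
NOT proved.
-/

set_option autoImplicit false

noncomputable section

namespace Summit.Ventures.HodgeRepro.PeriodCloser

open NumberField

variable {L : Type} [Field L] [NumberField L] [IsCMField L]

/-- **The hypotheses of the chain with the identification REFINED**: `ChainHypothesesAdm I` of
`PeriodCloserC7Chain.lean` with its field `ident` replaced by the two component interfaces and their component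
bundles; every other field is PRINTED or ROUTE-DERIVED as its own docstring states. -/
structure ChainHypothesesRefined (I : C7Face L) where
  /-- the doubling interface -/
  D : DoublingInterface I
  /-- the components (D0)–(D4) of the doubling form -/
  hD : DoublingComponents I D
  /-- the spectral interface -/
  S : SpectralInterface I
  /-- the components (S1)–(S3) of the seesaw form -/
  hS : SeesawComponents I S
  /-- Lemma Π -/
  lemmaPi : LemmaPi I
  /-- the witness `Y = f(X)` -/
  witness : PeriodWitness I
  /-- Borade et al. 2025 Thm 1.4 -/
  tp1 : Borade2025_Thm1_4 I
  /-- BHTY 2025 Thm 1.1 -/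
  bhty : BHTY2025_Thm1_1 I
  /-- BHTY 2025 Lemma 4.11, split case -/
  bhtySplit : BHTY2025_Lemma4_11_split I
  /-- `Ξ_𝔭` infinite; split ⟹ unramified -/
  xi : XiInfinite I
  /-- Tate's product formula -/
  productFormula : ProductFormula I
  /-- the sign flip of ROUTE-B §9.10, on admissible data -/
  flipAdm : FlipRootNumberAdm I
  /-- the local discharge -/
  discharge : LocalDischarge I
  /-- the admissible family -/
  family : AdmissibleFamily I

/-- The refined bundle gives the precise bundle of the chain: the identification is composed from its components,
every other field is carried over. -/
theorem ChainHypothesesRefined.toAdm (I : C7Face L) (H : ChainHypothesesRefined I) : ChainHypothesesAdm I :=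
  ⟨identification_of_components I H.D H.S H.hD H.hS, H.lemmaPi, H.witness, H.tp1, H.bhty, H.bhtySplit, H.xi,
    H.productFormula, H.flipAdm, H.discharge, H.family⟩

/-- **THE CLOSER C7 FROM THE COMPONENTS OF THE IDENTIFICATION**: `S4face_of_chain` with `Identification I`
replaced by (D0)–(D4) and (S1)–(S3).  What an interface theorem is: exactly as strong as the logical chain it
encodes; every automorphic object is a parameter; no statement of ROUTE.md (S4, S4 on the faces, (P)) is closed. -/
theorem S4face_of_components (I : C7Face L) (H : ChainHypothesesRefined I) : I.S4face :=
  S4face_of_chain I (ChainHypothesesRefined.toAdm I H)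

/-- **The chain of equivalences from the components** (ROUTE.md §4 item 2, v2.3): S4 for the face ⟺ a Weil-period
witness (Lemma Π); (P) ⟺ (P′) (from (S1)–(S3)); (P) ⟺ the torus period of `E^{(2,2)}(·, Φ_{1/2})` is non-zero
(from (D0)–(D4)); (P) ⟹ S4 for the face (the witness). -/
theorem chain_of_equivalences_of_components (I : C7Face L) (D : DoublingInterface I)
    (S : SpectralInterface I) (HD : DoublingComponents I D) (HS : SeesawComponents I S) (hPi : LemmaPi I)
    (hW : PeriodWitness I) :
    (I.S4face ↔ I.WeilPeriodWitness) ∧ (I.P ↔ I.P') ∧ (I.P ↔ I.TorusPeriodNonzero) ∧ (I.P → I.S4face) :=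
  chain_of_equivalences I (identification_of_components I D S HD HS) hPi hW

end Summit.Ventures.HodgeRepro.PeriodCloser

end
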